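import Mathlib
import Summits.KontsevichZagierPeriods.KontsevichZagierPeriods.Theorems.SoloInformedHarmonicReps
import Summits.KontsevichZagierPeriods.KontsevichZagierPeriods.Theorems.SoloInformedShuffleAll
import HarnessLib
import HarnessLib.Audit

/-!
# SoloInformed — THEOREM XLVI: Hoffman's harmonic product with a letter, at all depths, in `𝒫`

Solo programme `solo-KontsevichZagierPeriods-informed`, session s47 (PROGRAMME XLVI, file 7).

**THEOREM XLVI.** In the formal period ring `𝒫 = KZ.FormalPeriodRing` (periods modulo the three
Kontsevich–Zagier rules only), for every `c ≥ 2` and every admissible index `u` of ANY depth,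

  `mzvClass [c] · mzvClass u = Σ_{v ∈ [c] ∗ u} mzvClass v`      (`soloInformed_mzvClass_letter_mul`)

where `∗` is Hoffman's harmonic (stuffle) product `MZV.stuffle` of the Literature. The proof is by
naive moves alone: cube coordinates (rule 2), Fubini (rule 3), the rational identity
`G(Q)/(1−Y) = Σ G(ins_i) + Σ G(merge_i)` (file 2) as one `(2k+3)`-term instance of rule (1b),
and the block-sorting permutations (rule 2) identifying each term with a multiple zeta class
(files 1, 3–6); this file re-indexes the raw sum of file 6 by `MZV.stuffle [c] u`
(`soloInformed_sum_stuffle_letter`, Hoffman's rule (A3) with a letter on the left).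

Together with THEOREM XLII (the shuffle product at all depths) this puts BOTH of the regularised
double-shuffle structures' products — for a depth-one factor — inside `𝒫`, hence every linear
relation `Σ_{[c] ш u} Z = Σ_{[c] ∗ u} Z` ("Hoffman's relation" family when `c = 2`… here for all
`c ≥ 2`) holds between the ABSTRACT periods, not only numerically.

References: Hoffman 1992 §2, 1997 §2 (A1)–(A3); Kontsevich–Zagier 2001 §1.2; Zagier 1994 §9;
Ihara–Kaneko–Zagier 2006 §1.
-/

noncomputable section

open Literature.NumberTheory.Transcendental
open Literature.NumberTheory.Transcendental.KZ

namespace Summit.KontsevichZagierPeriods.KontsevichZagierPeriods.Theorems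

/-! ## 1. Hoffman's recursion for a letter, summed -/

/-- **`Σ_{v ∈ [c] ∗ u} f v = Σ_{i ≤ n} f (u.take i ++ c :: u.drop i) + Σ_{i < n} f (u.take i ++ (c+uᵢ) :: u.drop (i+1))`**
(`n = |u|`): the stuffle of a letter with a word is the sum of the insertions and the mergings.
[Hoffman 1997, §2 (A1)–(A3)] -/
theorem soloInformed_sum_stuffle_letter {A : Type*} [AddCommMonoid A] (c : ℕ) :
    ∀ (f : List ℕ → A) (u : List ℕ) (n : ℕ) (hn : u.length = n),
      ((MZV.stuffle [c] u).map f).sum =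
        ∑ i : Fin (n + 1), f (u.take i ++ c :: u.drop i) +
          ∑ i : Fin n, f (u.take i ++ (c + u[(i : ℕ)]'(by omega)) :: u.drop (i + 1))
  | f, [], n, hn => by
    subst hn
    simp
  | f, b :: t, n, hn => by
    obtain ⟨n, rfl⟩ : ∃ n', n = n' + 1 := ⟨n - 1, by simp at hn; omega⟩
    have hn' : t.length = n := by simpa using hn
    rw [MZV.stuffle_cons_cons, MZV.stuffle_nil_left, MZV.stuffle_nil_left, List.map_append,
      List.map_append, List.sum_append, List.sum_append]
    simp only [List.map_map]
    rw [soloInformed_sum_stuffle_letter c (f ∘ List.cons b) t n hn']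
    simp only [List.map_cons, List.map_nil, List.sum_cons, List.sum_nil, add_zero,
      Function.comp_apply, Fin.sum_univ_succ, Fin.val_zero, List.take_zero, List.drop_zero,
      List.nil_append, Fin.val_succ, List.take_succ_cons, List.drop_succ_cons, List.cons_append,
      List.getElem_cons_succ, List.getElem_cons_zero]
    abel

/-! ## 2. THEOREM XLVI -/

/-- **THEOREM XLVI (Hoffman's harmonic product with a letter, at all depths, in `𝒫`).**
For `c ≥ 2` and `u` admissible of any depth,
`mzvClass [c] · mzvClass u = ((MZV.stuffle [c] u).map mzvClass).sum` in `KZ.FormalPeriodRing` —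
by the three Kontsevich–Zagier rules alone. [Hoffman 1992 §2; KZ 2001 §1.2] -/
theorem soloInformed_mzvClass_letter_mul {c : ℕ} (hc : 2 ≤ c) {u : List ℕ}
    (hu : MZV.IsAdmissible u) :
    mzvClass [c] * mzvClass u = ((MZV.stuffle [c] u).map mzvClass).sum := by
  obtain ⟨a, rfl⟩ : ∃ a, c = a + 2 := ⟨c - 2, by omega⟩
  rcases u with _ | ⟨b, t⟩
  · simp
  have hb : 2 ≤ b := hu.2 (List.cons_ne_nil b t)
  have h1 : 1 ≤ MZV.weight (b :: t) := by
    simp only [MZV.weight, List.sum_cons]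
    omega
  rw [soloInformed_sum_stuffle_letter (a + 2) mzvClass (b :: t) (t.length + 1) (by simp), mul_comm]
  exact soloInformed_mzvClass_mul_letter_raw hu (Nat.sub_add_cancel h1).symm (by simp)

/-- THEOREM XLVI with the letter on the right. -/
theorem soloInformed_mzvClass_mul_letter {c : ℕ} (hc : 2 ≤ c) {u : List ℕ}
    (hu : MZV.IsAdmissible u) :
    mzvClass u * mzvClass [c] = ((MZV.stuffle [c] u).map mzvClass).sum := by
  rw [mul_comm, soloInformed_mzvClass_letter_mul hc hu]

/-! ## 3. Corollaries and checks -/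

/-- **Depth `1 × 2`.** For `a, b ≥ 2`, `c ≥ 1`:
`Z(a)·Z(b,c) = Z(a,b,c) + Z(b,a,c) + Z(b,c,a) + Z(a+b,c) + Z(b,a+c)` in `𝒫`. -/
theorem soloInformed_mzvClass_letter_mul_depthTwo {a b c : ℕ} (ha : 2 ≤ a) (hb : 2 ≤ b)
    (hc : 1 ≤ c) :
    mzvClass [a] * mzvClass [b, c] =
      mzvClass [a, b, c] + mzvClass [b, a, c] + mzvClass [b, c, a] + mzvClass [a + b, c] +
        mzvClass [b, a + c] := by
  rw [soloInformed_mzvClass_letter_mul ha (MZV.isAdmissible_pair hb hc)]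
  simp [MZV.stuffle]
  abel

/-- Smoke test (the Literature's example): `Z(2)·Z(2,1) = 2Z(2,2,1) + Z(2,1,2) + Z(2,3) + Z(4,1)`
in `𝒫`. -/
example : mzvClass [2] * mzvClass [2, 1] =
    2 • mzvClass [2, 2, 1] + mzvClass [2, 1, 2] + mzvClass [2, 3] + mzvClass [4, 1] := by
  rw [soloInformed_mzvClass_letter_mul le_rfl (by decide)]
  simp [MZV.stuffle]
  ring

/-- Smoke test at depth 3: `Z(3)·Z(2,1,1)` has `4 + 3 = 7` stuffle terms. -/
example : mzvClass [3] * mzvClass [2, 1, 1] =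
    mzvClass [3, 2, 1, 1] + mzvClass [2, 3, 1, 1] + mzvClass [2, 1, 3, 1] + mzvClass [2, 1, 1, 3] +
      mzvClass [5, 1, 1] + mzvClass [2, 4, 1] + mzvClass [2, 1, 4] := by
  rw [soloInformed_mzvClass_letter_mul (by norm_num) (by decide)]
  simp [MZV.stuffle]
  abel

/-- **Hoffman's relation family in `𝒫` (shuffle = stuffle for a letter).** For `c ≥ 2` and `u`
admissible, the shuffle-product sum (THEOREM XLII) and the stuffle-product sum (THEOREM XLVI) of
`[c]` with `u` agree in `𝒫`, both being `mzvClass [c] · mzvClass u`: the linear "double shuffle"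
relations with a depth-one factor hold between the abstract periods. [IKZ 2006 §1; Hoffman 1992] -/
theorem soloInformed_mzvClass_shuffle_eq_stuffle_letter {c : ℕ} (hc : 2 ≤ c) {u : List ℕ}
    (hu : MZV.IsAdmissible u) :
    ((MZV.shuffleWord (MZV.binaryWord [c]) (MZV.binaryWord u)).map
        fun W => mzvClass (MZV.ofBinaryWord W)).sum =
      ((MZV.stuffle [c] u).map mzvClass).sum := by
  rw [← soloInformed_mzvClass_letter_mul hc hu, ← soloInformed_mzvClass_mul_eq_sum_shuffleWord
    (MZV.isAdmissible_singleton_of_two_le hc) hu]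

end Summit.KontsevichZagierPeriods.KontsevichZagierPeriods.Theorems
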